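import Mathlib
import Literature.AlgebraicGeometry.Motives.Varieties
import Literature.AlgebraicGeometry.Resolution.Blowups
import Literature.AlgebraicGeometry.Resolution.BlowupsProperProofs
import Literature.AlgebraicGeometry.Resolution.ComponentGluing
import HarnessLib

/-!
# [OURS · L1 W4.5(b)] EL♮ — `EquisingularLiftNat`: the HONEST door of slot W4.5(b) (equisingular lifting with the ambient
# FIXED to `ℙⁿ_O` and every centre tied to the current strict transform) — deliverable (1) of director-resolution g3's
# RULING 2026-08-27T00:46:45Z / 00:51:42Z, typed on res-L1-w45b-plan-1's «o1 GO» + TYPED DOSSIER (STATUS 01:16:23Z,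
# L/w45b/EL-NATURAL/); cell res-hironaka (LADDER-RESOLUTION rung L, D-0089); host route EquisingularLift; `--kind definition
# --supports stmt-ResolutionOfSingularities-15660`

HONEST FRAMING. Everything below is OURS (campaign statements of the crux chain w45b, slot W4.5(b)), typed by res-L1-type-o1
(OURS typer of group G4, statement-only lane). The three Props are the planner's farm-checked texts BYTE-FOR-BYTE up to pulling the leading `∀ p : ℕ,` out as a
parameter (DESIGN POINT (PARAM): the gate relocates parameterless Props of `Theorems/`)
(`L/w45b/EL-NATURAL/sig-EquisingularLiftNat.importfree.txt` sha16 e7ca4a6668c5c33a = THE ITEM the route-repair seat adds as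
`Theses.EquisingularLift.EquisingularLiftNat` with the closed text, so `(∀ p, EquisingularLiftNat p)` and the route decl agree by `Iff.rfl` whichever lands first —
EL-NATURAL.md §4; `sig-EquisingularLiftNatA.importfree.txt` 8407d8044dd5437b; the E2 text = `sig-EquisingularLiftNatSmooth.crystalline.txt`
45d7fca91cfefc0b with the Crystalline spelling of `P`/`q` replaced by the import-free one — the SAME substitution that turns the
planner's crystalline (A′) text aa3e50f843852b58 into the import-free one e7ca4a6668c5c33a, checked byte-for-byte). NOTHING here
is a statement of H. Hironaka's manuscript [Hironaka2017] (slot W4.5 DODGES the manuscript's termination problem); nothing is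
asserted: three `def … : Prop` and two pure-logic nesting theorems (the planner's, re-proved here). The instantiation
`EquisingularLiftNat → Theses.EquisingularLift.EquisingularLift` (the support item `EquisingularLiftOfNat`) is the companion
PROOF file `EquisingularLiftCampaignW45bEquisingularLiftNatInstantiation.lean`. Imports = the route file's (Mathlib + the four
Literature modules), so the texts elaborate exactly as they will in `Theses/EquisingularLift.lean` (planner's RouteContextTest
d76874e43e247bf0). AI review is weaker than expert review. No `sorry`.

MANDATORY WORDS (director 00:46:45Z, carried by the item and repeated on each door decl): «≥ S over k̄ for n ≥ 5
(LINEAR-CENTRE equivalence + HypersurfacesSuffice); plausibly strictly stronger (kangaroo-forced special-fibre collisions,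
route file l.274); the bet is MECHANISM — a terminating clock BORROWED from characteristic 0 (`Kollar2007Principalization_holds`
/ `Hironaka1964_holds` in the kernel) — not a reduction in strength; FRONTIER-class until K-LSE-1/K-LSE-3 report; T3 witness
EL♮(3) sits inside S's known regime (flag T3-plan-only)».

## The typed delta against `Theses.EquisingularLift.EquisingularLift` (stmt-15660, rev 1) — EL-NATURAL.md §2, verbatim decisions

KEPT: every outer binder (prime `p`, algebraically closed `k` of char `p`, `n`, integral closed `H ⊆ ℙⁿ_k` with locally
principal ideal, `ι` a closed immersion) and the whole conclusion (induction principle over towers of blow-ups in REGULAR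
centres over non-generic points of `Y`; IRREDUCIBLE special fibre of `P′ → Spec O`; REGULAR reduced closure of `S′`).
REPLACED: the existential ambient block by the FIXED `P := ℙⁿ_O = Proj (MvPolynomial.homogeneousSubmodule (Fin (n+1)) O)`
(import-free spelling; `= (Literature.AlgebraicGeometry.Crystalline.projectiveSpaceOver n O).left` by `rfl`), `q := Proj.toSpecZero _ ≫
Spec (O → O[x]₀)` (VERBATIM the `q` of the toolkit's `stub_projectiveAmbientSmoothProper` p159079 / `stub_projectiveAmbientFibre`
p160143), `Y := Set.range (ι ≫ Proj.map φ hφ')` for EVERY graded `φ : O[x] →ᵍ k[x]` with `∀ s, φ s = MvPolynomial.map π s` (the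
interface of `ProjectiveAmbientFibre.isPullback_projMap`; non-vacuous via `⟨MvPolynomial.map π, fun h ↦ h.map π⟩` +
`irrelevant_le_map_gradedMap`; `Y` enters as a SET through `∀ Y, Y = range … →`), `O` existential = a characteristic-0 DVR with
a SURJECTION `π : O →+* k` («residue field k», the toolkit's convention, `stub_wittRing` p158907). DROPPED from the statement
(now THEOREMS about the fixed data, re-derived in the instantiation proof): `Smooth q ∧ IsProper q ∧ Y ⊆ q⁻¹{closed point} ∧
Nonempty (V(Y) ≅ H)`. ADDED (director 00:51:42Z, res-L1-w45b-tri-2 TRIAGE v2 §6.2 conjunct E1): one extra hypothesis of the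
inductive step after the generic-point clause, «the special support of the centre lies in the current strict transform»:
`(C.support : Set X′) ∩ (σ′ ≫ q)⁻¹{closedPoint O} ⊆ Y′ →` (more step hypotheses ⇒ smaller inductive closure ⇒ STRONGER).

## Decls (namespace `…Theorems`; FQ names differ from the future route decls `…Theses.EquisingularLift.*` only by namespace)

* `EquisingularLiftNat p` — **THE ITEM (A′)** per prime: `sig-EquisingularLiftNat.importfree.txt` with the leading `∀ p : ℕ,` pulled
  out as the parameter (DESIGN POINT (PARAM)); `∀ p, EquisingularLiftNat p` is the item text by `Iff.rfl`.
* `EquisingularLiftNatSmooth p` — E2 = E1 ∧ «the centre is `O`-SMOOTH» (`Smooth (C.subschemeι ≫ σ′ ≫ q)`): the chain's WORKING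
  STRENGTHENING (director 00:51:42Z «filed later as support» — typed here so support files have the name; NOT the item).
* `EquisingularLiftNatA p` — §6b (A) WITHOUT E1 (record only; tri-2: «P fixed ALONE is not yet honest»): the middle term of the
  chain toward `EquisingularLift`.
* Pure logic (planner's nesting lemmas, per prime): `equisingularLiftNat_of_smooth : EquisingularLiftNatSmooth p →
  EquisingularLiftNat p`, `equisingularLiftNatA_of_nat : EquisingularLiftNat p → EquisingularLiftNatA p`.

## DESIGN POINTS = EL-NATURAL.md §2 (1)–(7), not repeated; plus

* (PARAM) the gate RELOCATES parameterless `def … : Prop` in `Theorems/` to `Literature/` (first filing p482378 bounced exactly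
  so), hence the prime `p` is PULLED OUT as a parameter: `EquisingularLiftNat p := p.Prime → ∀ k …` — the definiens is the item
  text with its leading `∀ p : ℕ,` removed and NOTHING else changed, so `(∀ p, EquisingularLiftNat p) ↔ <item text>` is `Iff.rfl`
  (the bridge of EL-NATURAL.md §4, to be written by whoever lands second); same for the E2 / (A) forms.
* (VAC) VACUITY (planner's BC7 probe b23c8cc70f52c475: CLEAN — `exact?` fails, hypotheses not vacuous, none refutable): for
  `n ≥ 5` EL♮(n) implies resolution of all integral hypersurfaces of `ℙⁿ_k̄`; the `∀ φ` is inhabited; `O = 𝕎(k)`, `π` exist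
  (p158907). FRONTIER-class (director).

## References

* L/w45b/EL-NATURAL/{EL-NATURAL.md 2757839ceaf8cc1a, SketchELnat.lean 531ceefb62ca2322, RouteContextTest.lean, sig-*.txt,
  informal-*.txt} (res-L1-w45b-plan-1 gen 4, 2026-08-27T01:1xZ); plan/RESCUE-SEED.md v0.6.2 §6b (A)/(A′)/(B)/(C) (res-plan-2);
  HOME/INBOX director-resolution g3 00:46:45Z, 00:51:42Z; L/res-L1-w45b-tri-2 TRIAGE v2 §6.2; route file
  Theses/EquisingularLift.lean (stmt-15660) — OURS planning texts, index only.
* J. Kollár, *Lectures on Resolution of Singularities* (2007) Thm. 3.21; H. Hironaka, Ann. Math. 79 (1964) — the borrowed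
  clock, context only. T. Kawakami–M. Nagaoka [arXiv:2008.07700] Prop. 6.4; KTTWYY II [arXiv:2302.13235]; C. Liedtke–
  M. Satriano [arXiv:1202.2942] Thm. 1.1; F. Bernasconi–I. Brivio–T. Kawakami–J. Witaszek, Crelle (2024) Thm. 1.3;
  R. Hartshorne, *Algebraic Geometry* II Rem. 7.17.2 — log-liftability prior art, context only. Q. Liu (2002) Prop. 3.1.9.
-/

noncomputable section

set_option linter.dupNamespace false -- mandated namespace of this single-conjunct summit

namespace Summit.ResolutionOfSingularities.ResolutionOfSingularities.Theorems

/-- [OURS · L1 W4.5(b)] **EL♮ = `EquisingularLiftNat` — THE ITEM (§6b (A′); director-resolution g3 RULINGS 2026-08-27T00:46:45Z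
option (a) + 00:51:42Z (A′) adopted)**, per prime `p`: the planner's `sig-EquisingularLiftNat.importfree.txt` (e7ca4a6668c5c33a)
byte-for-byte after its leading `∀ p : ℕ,` ((PARAM); the item = `∀ p, EquisingularLiftNat p` by `Iff.rfl`):
`EquisingularLift` (stmt-15660) with the ambient FIXED to `P := ℙⁿ_O = Proj O[x₀,…,xₙ]`, `q :=` its structure morphism, `Y :=`
the image of `H` under `ι ≫ Proj.map φ` (`φ = MvPolynomial.map π` graded, universally quantified), `O` an existential
characteristic-0 DVR with a surjection `π : O → k`, AND on every step of the blow-up chain E1 «the special-fibre points of the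
REGULAR centre lie in the CURRENT strict transform». Conclusion as EL: chain clause, IRREDUCIBLE special fibre of the last
ambient, REGULAR reduced closure of the strict transform. Replaces the role of NOTHING in the manuscript; NOT a statement of
the manuscript. «≥ S over k̄ for n ≥ 5 (LINEAR-CENTRE equivalence + HypersurfacesSuffice); plausibly strictly stronger; the bet is MECHANISM — a terminating clock
borrowed from characteristic 0 — not a reduction in strength; FRONTIER-class until K-LSE-1/K-LSE-3 report; EL♮(3) is
T3-plan-only.» [folklore] -/
def EquisingularLiftNat (p : ℕ) : Prop :=
  p.Prime → ∀ (k : Type) [Field k] [CharP k p] [IsAlgClosed k] (n : ℕ) (H : AlgebraicGeometry.Scheme.{0}) (ι : H ⟶ (Literature.AlgebraicGeometry.Motives.projectiveSpace n k).left), AlgebraicGeometry.IsClosedImmersion ι → AlgebraicGeometry.IsIntegral H → (∀ y : (Literature.AlgebraicGeometry.Motives.projectiveSpace n k).left, ∃ U : (Literature.AlgebraicGeometry.Motives.projectiveSpace n k).left.affineOpens, y ∈ (U : (Literature.AlgebraicGeometry.Motives.projectiveSpace n k).left.Opens) ∧ (ι.ker.ideal U).IsPrincipal) → ∃ (O : Type)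 (_ : CommRing O) (_ : IsDomain O) (_ : IsDiscreteValuationRing O) (_ : CharZero O) (π : O →+* k), Function.Surjective π ∧ (letI := MvPolynomial.gradedAlgebra (σ := Fin (n + 1)) (R := O); letI := MvPolynomial.gradedAlgebra (σ := Fin (n + 1)) (R := k); ∀ (φ : MvPolynomial.homogeneousSubmodule (Fin (n + 1)) O →+*ᵍ MvPolynomial.homogeneousSubmodule (Fin (n + 1)) k) (hφ' : HomogeneousIdeal.irrelevant (MvPolynomial.homogeneousSubmodule (Fin (n + 1)) k) ≤ (HomogeneousIdeal.irrelevant (MvPolynomial.homogeneousSubmodule (Fin (n + 1)) O)).map φ), (∀ s, φ s = MvPolynomial.map π s) → ∀ Y : Set (AlgebraicGeometry.Proj (MvPolynomial.homogeneousSubmodule (Fin (n + 1)) O)), Y = Set.range (CategoryTheory.CategoryStruct.comp ι (AlgebraicGeometry.Proj.map φ hφ') : H ⟶ (AlgebraicGeometry.Proj (MvPolynomial.homogeneousSubmodule (Fin (n + 1)) O))) → ∃ (P' : AlgebraicGeometry.Scheme.{0}) (σ : P' ⟶ (AlgebraicGeometry.Proj (MvPolynomial.homogeneousSubmodule (Fin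 (n + 1)) O))) (S' : Set P'), (∀ Q : (∀ X' : AlgebraicGeometry.Scheme.{0}, (X' ⟶ (AlgebraicGeometry.Proj (MvPolynomial.homogeneousSubmodule (Fin (n + 1)) O))) → Set X' → Prop), Q (AlgebraicGeometry.Proj (MvPolynomial.homogeneousSubmodule (Fin (n + 1)) O)) (CategoryTheory.CategoryStruct.id _) Y → (∀ (X' X'' : AlgebraicGeometry.Scheme.{0}) (σ' : X' ⟶ (AlgebraicGeometry.Proj (MvPolynomial.homogeneousSubmodule (Fin (n + 1)) O))) (Y' : Set X') (C : X'.IdealSheafData) (τ : X'' ⟶ X'), Q X' σ' Y' → Literature.AlgebraicGeometry.Resolution.IsBlowup τ C → Literature.AlgebraicGeometry.Resolution.Scheme.IsRegular C.subscheme → σ' '' (C.support : Set X') ⊆ {x | ¬ IsGenericPoint x Y} → (C.support : Set X') ∩ (CategoryTheory.CategoryStruct.comp σ' (CategoryTheory.CategoryStruct.comp (AlgebraicGeometry.Proj.toSpecZero (MvPolynomial.homogeneousSubmodule (Fin (n + 1)) O)) (AlgebraicGeometry.Spec.map (CommRingCat.ofHom (algebraMap O (MvPolynomial.homogeneousSubmodule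 (Fin (n + 1)) O 0)))))) ⁻¹' {IsLocalRing.closedPoint O} ⊆ Y' → Q X'' (CategoryTheory.CategoryStruct.comp τ σ') (closure (τ ⁻¹' (Y' \ (C.support : Set X'))))) → Q P' σ S') ∧ IsIrreducible ((CategoryTheory.CategoryStruct.comp σ (CategoryTheory.CategoryStruct.comp (AlgebraicGeometry.Proj.toSpecZero (MvPolynomial.homogeneousSubmodule (Fin (n + 1)) O)) (AlgebraicGeometry.Spec.map (CommRingCat.ofHom (algebraMap O (MvPolynomial.homogeneousSubmodule (Fin (n + 1)) O 0)))))) ⁻¹' {IsLocalRing.closedPoint O}) ∧ Literature.AlgebraicGeometry.Resolution.Scheme.IsRegular (AlgebraicGeometry.Scheme.IdealSheafData.vanishingIdeal (⟨closure S', isClosed_closure⟩ : TopologicalSpace.Closeds P')).subscheme)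

/-- [OURS · L1 W4.5(b)] **EL♮ with `O`-SMOOTH centres = `EquisingularLiftNatSmooth` (E2)**: as `EquisingularLiftNat` with one more
hypothesis of the inductive step, `Smooth (C.subschemeι ≫ σ′ ≫ q)` — the equisingular game the chain actually plays (sections,
toric stars, linked c.i., free arcs, inflate–foresee); excludes ramified centres. The chain's WORKING STRENGTHENING (director
00:51:42Z: «filed later as support»), NOT the item; text = the planner's `sig-EquisingularLiftNatSmooth.crystalline.txt`
(45d7fca91cfefc0b) in the import-free spelling, `p` pulled out (PARAM). NOT a statement of the manuscript. «≥ S over k̄ for n ≥ 5 (LINEAR-CENTRE equivalence + HypersurfacesSuffice); plausibly strictly stronger; the bet is MECHANISM — a terminating clock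
borrowed from characteristic 0 — not a reduction in strength; FRONTIER-class until K-LSE-1/K-LSE-3 report; EL♮(3) is
T3-plan-only.» [folklore] -/
def EquisingularLiftNatSmooth (p : ℕ) : Prop :=
  p.Prime → ∀ (k : Type) [Field k] [CharP k p] [IsAlgClosed k] (n : ℕ) (H : AlgebraicGeometry.Scheme.{0}) (ι : H ⟶ (Literature.AlgebraicGeometry.Motives.projectiveSpace n k).left), AlgebraicGeometry.IsClosedImmersion ι → AlgebraicGeometry.IsIntegral H → (∀ y : (Literature.AlgebraicGeometry.Motives.projectiveSpace n k).left, ∃ U : (Literature.AlgebraicGeometry.Motives.projectiveSpace n k).left.affineOpens, y ∈ (U : (Literature.AlgebraicGeometry.Motives.projectiveSpace n k).left.Opens) ∧ (ι.ker.ideal U).IsPrincipal) → ∃ (O : Type) (_ : CommRing O) (_ : IsDomain O) (_ : IsDiscreteValuationRing O) (_ : CharZero O) (π : O →+* k), Function.Surjective π ∧ (letI := MvPolynomial.gradedAlgebra (σ := Fin (n + 1)) (R := O); letI := MvPolynomial.gradedAlgebra (σ := Fin (n + 1)) (R := k); ∀ (φ : MvPolynomial.homogeneousSubmodule (Fin (n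 + 1)) O →+*ᵍ MvPolynomial.homogeneousSubmodule (Fin (n + 1)) k) (hφ' : HomogeneousIdeal.irrelevant (MvPolynomial.homogeneousSubmodule (Fin (n + 1)) k) ≤ (HomogeneousIdeal.irrelevant (MvPolynomial.homogeneousSubmodule (Fin (n + 1)) O)).map φ), (∀ s, φ s = MvPolynomial.map π s) → ∀ Y : Set (AlgebraicGeometry.Proj (MvPolynomial.homogeneousSubmodule (Fin (n + 1)) O)), Y = Set.range (CategoryTheory.CategoryStruct.comp ι (AlgebraicGeometry.Proj.map φ hφ') : H ⟶ (AlgebraicGeometry.Proj (MvPolynomial.homogeneousSubmodule (Fin (n + 1)) O))) → ∃ (P' : AlgebraicGeometry.Scheme.{0}) (σ : P' ⟶ (AlgebraicGeometry.Proj (MvPolynomial.homogeneousSubmodule (Fin (n + 1)) O))) (S' : Set P'), (∀ Q : (∀ X' : AlgebraicGeometry.Scheme.{0}, (X' ⟶ (AlgebraicGeometry.Proj (MvPolynomial.homogeneousSubmodule (Fin (n + 1)) O))) → Set X' → Prop), Q (AlgebraicGeometry.Proj (MvPolynomial.homogeneousSubmodule (Fin (n + 1)) O)) (CategoryTheory.CategoryStruct.id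 _) Y → (∀ (X' X'' : AlgebraicGeometry.Scheme.{0}) (σ' : X' ⟶ (AlgebraicGeometry.Proj (MvPolynomial.homogeneousSubmodule (Fin (n + 1)) O))) (Y' : Set X') (C : X'.IdealSheafData) (τ : X'' ⟶ X'), Q X' σ' Y' → Literature.AlgebraicGeometry.Resolution.IsBlowup τ C → Literature.AlgebraicGeometry.Resolution.Scheme.IsRegular C.subscheme → σ' '' (C.support : Set X') ⊆ {x | ¬ IsGenericPoint x Y} → (C.support : Set X') ∩ (CategoryTheory.CategoryStruct.comp σ' (CategoryTheory.CategoryStruct.comp (AlgebraicGeometry.Proj.toSpecZero (MvPolynomial.homogeneousSubmodule (Fin (n + 1)) O)) (AlgebraicGeometry.Spec.map (CommRingCat.ofHom (algebraMap O (MvPolynomial.homogeneousSubmodule (Fin (n + 1)) O 0)))))) ⁻¹' {IsLocalRing.closedPoint O} ⊆ Y' → AlgebraicGeometry.Smooth (CategoryTheory.CategoryStruct.comp C.subschemeι (CategoryTheory.CategoryStruct.comp σ' (CategoryTheory.CategoryStruct.comp (AlgebraicGeometry.Proj.toSpecZero (MvPolynomial.homogeneousSubmodule (Fin (n + 1)) O))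 (AlgebraicGeometry.Spec.map (CommRingCat.ofHom (algebraMap O (MvPolynomial.homogeneousSubmodule (Fin (n + 1)) O 0))))))) → Q X'' (CategoryTheory.CategoryStruct.comp τ σ') (closure (τ ⁻¹' (Y' \ (C.support : Set X'))))) → Q P' σ S') ∧ IsIrreducible ((CategoryTheory.CategoryStruct.comp σ (CategoryTheory.CategoryStruct.comp (AlgebraicGeometry.Proj.toSpecZero (MvPolynomial.homogeneousSubmodule (Fin (n + 1)) O)) (AlgebraicGeometry.Spec.map (CommRingCat.ofHom (algebraMap O (MvPolynomial.homogeneousSubmodule (Fin (n + 1)) O 0)))))) ⁻¹' {IsLocalRing.closedPoint O}) ∧ Literature.AlgebraicGeometry.Resolution.Scheme.IsRegular (AlgebraicGeometry.Scheme.IdealSheafData.vanishingIdeal (⟨closure S', isClosed_closure⟩ : TopologicalSpace.Closeds P')).subscheme)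

/-- [OURS · L1 W4.5(b)] **EL♮ variant (A) = `EquisingularLiftNatA`** (RESCUE-SEED v0.6 §6b (A), WITHOUT E1; byte-for-byte the
planner's `sig-EquisingularLiftNatA.importfree.txt` 8407d8044dd5437b, `p` pulled out (PARAM)): RECORD ONLY — res-L1-w45b-tri-2: «P fixed ALONE is NOT yet
honest (regular `O`-flat centres unrelated to `Sing H` still compose)»; the middle term of `EquisingularLiftNatSmooth →
EquisingularLiftNat → EquisingularLiftNatA → EquisingularLift`. NOT the item; NOT a statement of the manuscript. [folklore] -/
def EquisingularLiftNatA (p : ℕ) : Prop :=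
  p.Prime → ∀ (k : Type) [Field k] [CharP k p] [IsAlgClosed k] (n : ℕ) (H : AlgebraicGeometry.Scheme.{0}) (ι : H ⟶ (Literature.AlgebraicGeometry.Motives.projectiveSpace n k).left), AlgebraicGeometry.IsClosedImmersion ι → AlgebraicGeometry.IsIntegral H → (∀ y : (Literature.AlgebraicGeometry.Motives.projectiveSpace n k).left, ∃ U : (Literature.AlgebraicGeometry.Motives.projectiveSpace n k).left.affineOpens, y ∈ (U : (Literature.AlgebraicGeometry.Motives.projectiveSpace n k).left.Opens) ∧ (ι.ker.ideal U).IsPrincipal) → ∃ (O : Type) (_ : CommRing O) (_ : IsDomain O) (_ : IsDiscreteValuationRing O) (_ : CharZero O) (π : O →+* k), Function.Surjective π ∧ (letI := MvPolynomial.gradedAlgebra (σ := Fin (n + 1)) (R := O); letI := MvPolynomial.gradedAlgebra (σ := Fin (n + 1)) (R := k); ∀ (φ : MvPolynomial.homogeneousSubmodule (Fin (n + 1)) O →+*ᵍ MvPolynomial.homogeneousSubmodule (Fin (n + 1)) k) (hφ' : HomogeneousIdeal.irrelevant (MvPolynomial.homogeneousSubmodule (Fin (n + 1)) k) ≤ (HomogeneousIdeal.irrelevant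 (MvPolynomial.homogeneousSubmodule (Fin (n + 1)) O)).map φ), (∀ s, φ s = MvPolynomial.map π s) → ∀ Y : Set (AlgebraicGeometry.Proj (MvPolynomial.homogeneousSubmodule (Fin (n + 1)) O)), Y = Set.range (CategoryTheory.CategoryStruct.comp ι (AlgebraicGeometry.Proj.map φ hφ') : H ⟶ (AlgebraicGeometry.Proj (MvPolynomial.homogeneousSubmodule (Fin (n + 1)) O))) → ∃ (P' : AlgebraicGeometry.Scheme.{0}) (σ : P' ⟶ (AlgebraicGeometry.Proj (MvPolynomial.homogeneousSubmodule (Fin (n + 1)) O))) (S' : Set P'), (∀ Q : (∀ X' : AlgebraicGeometry.Scheme.{0}, (X' ⟶ (AlgebraicGeometry.Proj (MvPolynomial.homogeneousSubmodule (Fin (n + 1)) O))) → Set X' → Prop), Q (AlgebraicGeometry.Proj (MvPolynomial.homogeneousSubmodule (Fin (n + 1)) O)) (CategoryTheory.CategoryStruct.id _) Y → (∀ (X' X'' : AlgebraicGeometry.Scheme.{0}) (σ' : X' ⟶ (AlgebraicGeometry.Proj (MvPolynomial.homogeneousSubmodule (Fin (n + 1)) O))) (Y' : Set X') (C : X'.IdealSheafData)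 (τ : X'' ⟶ X'), Q X' σ' Y' → Literature.AlgebraicGeometry.Resolution.IsBlowup τ C → Literature.AlgebraicGeometry.Resolution.Scheme.IsRegular C.subscheme → σ' '' (C.support : Set X') ⊆ {x | ¬ IsGenericPoint x Y} → Q X'' (CategoryTheory.CategoryStruct.comp τ σ') (closure (τ ⁻¹' (Y' \ (C.support : Set X'))))) → Q P' σ S') ∧ IsIrreducible ((CategoryTheory.CategoryStruct.comp σ (CategoryTheory.CategoryStruct.comp (AlgebraicGeometry.Proj.toSpecZero (MvPolynomial.homogeneousSubmodule (Fin (n + 1)) O)) (AlgebraicGeometry.Spec.map (CommRingCat.ofHom (algebraMap O (MvPolynomial.homogeneousSubmodule (Fin (n + 1)) O 0)))))) ⁻¹' {IsLocalRing.closedPoint O}) ∧ Literature.AlgebraicGeometry.Resolution.Scheme.IsRegular (AlgebraicGeometry.Scheme.IdealSheafData.vanishingIdeal (⟨closure S', isClosed_closure⟩ : TopologicalSpace.Closeds P')).subscheme)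

/-! ## Pure logic: the nesting (res-L1-w45b-plan-1's lemmas, SketchELnat.lean 531ceefb62ca2322) -/

/-- Pure logic, nesting step 1: E2-chains are E1-chains (more step hypotheses ⇒ smaller inductive closure), so the `O`-smooth
form implies the item. [folklore] -/
theorem equisingularLiftNat_of_smooth {p : ℕ} : EquisingularLiftNatSmooth p → EquisingularLiftNat p := by
  intro h hp k _ _ _ n H ι hι hH hloc
  obtain ⟨O, i1, i2, i3, i4, π, hπ, h'⟩ := h hp k n H ι hι hH hloc
  refine ⟨O, i1, i2, i3, i4, π, hπ, ?_⟩
  intro φ hφ' hφ Y hY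
  obtain ⟨P', σ, S', hchain, hirr, hreg⟩ := h' φ hφ' hφ Y hY
  refine ⟨P', σ, S', ?_, hirr, hreg⟩
  intro Q hQ0 hstep
  exact hchain Q hQ0 (fun X' X'' σ' Y' C τ hQ hbl hC hgen hE1 _hE2 => hstep X' X'' σ' Y' C τ hQ hbl hC hgen hE1)

/-- Pure logic, nesting step 2: E1-chains are chains, so the item (A′) implies (A). [folklore] -/
theorem equisingularLiftNatA_of_nat {p : ℕ} : EquisingularLiftNat p → EquisingularLiftNatA p := by
  intro h hp k _ _ _ n H ι hι hH hloc
  obtain ⟨O, i1, i2, i3, i4, π, hπ, h'⟩ := h hp k n H ι hι hH hloc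
  refine ⟨O, i1, i2, i3, i4, π, hπ, ?_⟩
  intro φ hφ' hφ Y hY
  obtain ⟨P', σ, S', hchain, hirr, hreg⟩ := h' φ hφ' hφ Y hY
  refine ⟨P', σ, S', ?_, hirr, hreg⟩
  intro Q hQ0 hstep
  exact hchain Q hQ0 (fun X' X'' σ' Y' C τ hQ hbl hC hgen _hE1 => hstep X' X'' σ' Y' C τ hQ hbl hC hgen)

/-! ## v2 APPEND (2026-08-27): the ∃g «signature form» of res-L1-w45b-plan-1's ALIGNMENT 01:22:16Z / EL-NATURAL v1.1 §6
## (`sig-EquisingularLiftNat.o1design.importfree.txt` 331c8cf6f0e88ded) — SAME DOOR as `EquisingularLiftNat` (planner: «such a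
## g is an iso onto the special fibre = canonical up to Aut ℙⁿ_k = PGL_{n+1}(k), liftable to PGL_{n+1}(O)»); typed so that
## WHICHEVER of the two texts the route-repair seat registers as the item, an OURS decl agrees with it by `Iff.rfl` and the
## companion proof file supplies `Nat → Sig` and `Sig → EquisingularLift` (v2 of that file). -/

/-- [OURS · L1 W4.5(b)] **EL♮, SIGNATURE FORM — `EquisingularLiftNatSig p`** = the planner's import-free rendering of o1's ∃g
design (`sig-EquisingularLiftNat.o1design.importfree.txt`, 331c8cf6f0e88ded) with the leading `∀ p : ℕ,` pulled out as the
parameter (DESIGN POINT (PARAM)): for prime `p`, every `n`, every algebraically closed `k` of char `p` and integral closed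
`H ⊆ ℙⁿ_k` with locally principal ideal, there are a characteristic-0 DVR `O` with a surjection `π : O → k`, ANY closed immersion
`g : ℙⁿ_k ⟶ ℙⁿ_O` over `Spec π`, and a tower from `Y := closure (range (ι ≫ g))` with E1-steps, irreducible special fibre and
regular reduced closure — `EquisingularLiftNat p` with the canonical `Proj.map (MvPolynomial.map π)` replaced by an existential
`g` (and `n` bound before `k`). `EquisingularLiftNat p → EquisingularLiftNatSig p` and `(∀ p, EquisingularLiftNatSig p) →
EquisingularLift` are in the companion proof file (v2). NOT a statement of the manuscript. «≥ S over k̄ for n ≥ 5; the bet is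
MECHANISM (a clock borrowed from characteristic 0); FRONTIER-class until K-LSE-1/K-LSE-3 report; EL♮(3) T3-plan-only.»
[folklore] -/
def EquisingularLiftNatSig (p : ℕ) : Prop :=
  p.Prime → ∀ n : ℕ, ∀ (k : Type) [Field k] [CharP k p] [IsAlgClosed k] (H : AlgebraicGeometry.Scheme.{0}) (ι : H ⟶ (Literature.AlgebraicGeometry.Motives.projectiveSpace n k).left), AlgebraicGeometry.IsClosedImmersion ι → AlgebraicGeometry.IsIntegral H → (∀ y : (Literature.AlgebraicGeometry.Motives.projectiveSpace n k).left, ∃ U : (Literature.AlgebraicGeometry.Motives.projectiveSpace n k).left.affineOpens, y ∈ (U : (Literature.AlgebraicGeometry.Motives.projectiveSpace n k).left.Opens) ∧ (ι.ker.ideal U).IsPrincipal) → ∃ (O : Type) (_ : CommRing O) (_ : IsDomain O) (_ : IsDiscreteValuationRing O) (_ : CharZero O) (π : O →+* k) (_ : Function.Surjective π), (letI := MvPolynomial.gradedAlgebra (σ := Fin (n + 1)) (R := O); ∃ (g : (Literature.AlgebraicGeometry.Motives.projectiveSpace n k).left ⟶ (AlgebraicGeometry.Proj (MvPolynomial.homogeneousSubmodule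 (Fin (n + 1)) O))) (_ : AlgebraicGeometry.IsClosedImmersion g) (_ : CategoryTheory.CategoryStruct.comp g (CategoryTheory.CategoryStruct.comp (AlgebraicGeometry.Proj.toSpecZero (MvPolynomial.homogeneousSubmodule (Fin (n + 1)) O)) (AlgebraicGeometry.Spec.map (CommRingCat.ofHom (algebraMap O (MvPolynomial.homogeneousSubmodule (Fin (n + 1)) O 0))))) = CategoryTheory.CategoryStruct.comp (Literature.AlgebraicGeometry.Motives.projectiveSpace n k).hom (AlgebraicGeometry.Spec.map (CommRingCat.ofHom π))) (P' : AlgebraicGeometry.Scheme.{0}) (σ : P' ⟶ (AlgebraicGeometry.Proj (MvPolynomial.homogeneousSubmodule (Fin (n + 1)) O))) (S' : Set P'), (∀ Q : (∀ X' : AlgebraicGeometry.Scheme.{0}, (X' ⟶ (AlgebraicGeometry.Proj (MvPolynomial.homogeneousSubmodule (Fin (n + 1)) O))) → Set X' → Prop), Q (AlgebraicGeometry.Proj (MvPolynomial.homogeneousSubmodule (Fin (n + 1)) O)) (CategoryTheory.CategoryStruct.id _) (closure (Set.range (CategoryTheory.CategoryStruct.comp ι g).base)) → (∀ (X' X'' :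 AlgebraicGeometry.Scheme.{0}) (σ' : X' ⟶ (AlgebraicGeometry.Proj (MvPolynomial.homogeneousSubmodule (Fin (n + 1)) O))) (Y' : Set X') (C : X'.IdealSheafData) (τ : X'' ⟶ X'), Q X' σ' Y' → Literature.AlgebraicGeometry.Resolution.IsBlowup τ C → Literature.AlgebraicGeometry.Resolution.Scheme.IsRegular C.subscheme → σ' '' (C.support : Set X') ⊆ {x : (AlgebraicGeometry.Proj (MvPolynomial.homogeneousSubmodule (Fin (n + 1)) O)) | ¬ IsGenericPoint x (closure (Set.range (CategoryTheory.CategoryStruct.comp ι g).base))} → (C.support : Set X') ∩ (CategoryTheory.CategoryStruct.comp σ' (CategoryTheory.CategoryStruct.comp (AlgebraicGeometry.Proj.toSpecZero (MvPolynomial.homogeneousSubmodule (Fin (n + 1)) O)) (AlgebraicGeometry.Spec.map (CommRingCat.ofHom (algebraMap O (MvPolynomial.homogeneousSubmodule (Fin (n + 1)) O 0)))))) ⁻¹' {IsLocalRing.closedPoint O} ⊆ Y' → Q X'' (CategoryTheory.CategoryStruct.comp τ σ') (closure (τ ⁻¹' (Y' \ (C.support : Set X'))))) → Q P' σ S') ∧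 IsIrreducible ((CategoryTheory.CategoryStruct.comp σ (CategoryTheory.CategoryStruct.comp (AlgebraicGeometry.Proj.toSpecZero (MvPolynomial.homogeneousSubmodule (Fin (n + 1)) O)) (AlgebraicGeometry.Spec.map (CommRingCat.ofHom (algebraMap O (MvPolynomial.homogeneousSubmodule (Fin (n + 1)) O 0)))))) ⁻¹' {IsLocalRing.closedPoint O}) ∧ Literature.AlgebraicGeometry.Resolution.Scheme.IsRegular (AlgebraicGeometry.Scheme.IdealSheafData.vanishingIdeal (⟨closure S', isClosed_closure⟩ : TopologicalSpace.Closeds P')).subscheme)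

end Summit.ResolutionOfSingularities.ResolutionOfSingularities.Theorems

end
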